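import Literature.MathematicalPhysics.QuantumLattice.DWaveOrderParameterProofs
import Literature.MathematicalPhysics.QuantumLattice.FinDimSpectrumGibbsLimitProofs
import Summits.HubbardSuperconductivity.HubbardSuperconductivity.Theses.AposterioriCapRg
import HarnessLib

/-!
# The operator-side stair of every line of `AposterioriOrderCriterionR`: a Gibbs-state floor is a floor on
# the order parameter

Crux `stmt-HubbardSuperconductivity-13884` (route AposterioriCapRg), line lead attempt 1, 2026-08-16. Helper
(`--supports`), independent of the statement-level frame question X1: every line of the crux ends by transferring a
floor on the sourced anomalous density, obtained at finite `(L, β)` as a limit `M → ∞` of Grassmann quantities (the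
Matsubara bridge lands in a GIBBS state `ω_{β}`), to the Koma–Tasaki order parameter
`dWaveOrderParameter U μ = liminf_{h→0⁺} liminf_L Re ω₀^{L+1,h}(Δ_d)/(L+1)²` (ground state FIRST in `β`, then `L → ∞`,
then `h ↓ 0`). This file proves that transfer once, in the tree's vocabulary:

* `dWaveSourceDensity_ge_of_gibbs_floor` — at fixed `(L, h)`: if `m ≤ Re ω_β(Δ_d)/L²` for all large `β` then
  `m ≤ dWaveSourceDensity L U μ h` (zero-temperature limit `Matrix.tendsto_gibbsState_atTop_holds`);
* **`le_dWaveOrderParameter_of_gibbs_floor`** — if for every `h ∈ (0, h₀)` and every `ε > 0`, eventually in `L`,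
  `m - ε ≤ Re ω_β^{L+1,h}(Δ_d)/(L+1)²` for all large `β`, then `m ≤ dWaveOrderParameter U μ`
  (`le_dWaveOrderParameter_of_forall`, `le_liminf_of_le` with the a priori bound `dWaveSourceDensity_le_const`).

With the operator model read at whatever chemical potential the Grassmann side describes (X1: `μ + U/2` for the
current `hubbardInteraction`), this is the last step of `AposterioriOrderCriterionR_of` in the octave / Ward-flow /
scale-induction skeletons. [cite: KomaTasaki1994, §1]
-/

namespace Summit.HubbardSuperconductivity.HubbardSuperconductivity.Theorems

open Literature.MathematicalPhysics.QuantumLattice Literature.Probability.LatticeModels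
open Filter Set Matrix
open scoped Topology

noncomputable section

/-- **Zero-temperature limit of a Gibbs floor** (fixed torus and source): if `m ≤ Re ω_β(Δ_d)/L²` in the Gibbs state of
`dWaveSourceTorus L U μ h` for all `β ≥ β₁`, then `m ≤ dWaveSourceDensity L U μ h` (the tracial ground-state density),
by `ω_β → ω₀` (`Matrix.tendsto_gibbsState_atTop_holds`). [cite: KomaTasaki1994, §1] -/
theorem dWaveSourceDensity_ge_of_gibbs_floor (L : ℕ) [NeZero L] (U μ h : ℝ) {m β₁ : ℝ}
    (H : ∀ β : ℝ, β₁ ≤ β →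
      m ≤ (Matrix.gibbsState β (dWaveSourceTorus L U μ h) (pairField dWaveFormFactor L)).re / (L : ℝ) ^ 2) :
    m ≤ dWaveSourceDensity L U μ h := by
  have hH : (dWaveSourceTorus L U μ h).IsHermitian :=
    dWaveSourceTorus_isHermitian L (isHermitian_hubbardTorusWith L 1 U μ) h
  have hlim := Matrix.tendsto_gibbsState_atTop_holds hH (pairField dWaveFormFactor L)
  have hlim' : Tendsto (fun β : ℝ =>
      (Matrix.gibbsState β (dWaveSourceTorus L U μ h) (pairField dWaveFormFactor L)).re / (L : ℝ) ^ 2) atTop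
      (𝓝 (dWaveSourceDensity L U μ h)) := by
    rw [dWaveSourceDensity]
    exact ((Complex.continuous_re.tendsto _).comp hlim).div_const _
  exact ge_of_tendsto hlim' (eventually_atTop.2 ⟨β₁, H⟩)

/-- **A Gibbs-state floor, eventually in the volume and up to every `ε`, is a floor on the order parameter.** If for
every source `h ∈ (0, h₀)` and every `ε > 0`, for all large `L` there is `β₁` with
`m - ε ≤ Re ω_β^{L+1,h}(Δ_d)/(L+1)²` for all `β ≥ β₁`, then `m ≤ dWaveOrderParameter U μ`. [cite: KomaTasaki1994, §1] -/
theorem le_dWaveOrderParameter_of_gibbs_floor (U μ : ℝ) {m h₀ : ℝ} (hh₀ : 0 < h₀)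
    (H : ∀ h ∈ Set.Ioo (0:ℝ) h₀, ∀ ε : ℝ, 0 < ε → ∀ᶠ L : ℕ in atTop, ∃ β₁ : ℝ, ∀ β : ℝ, β₁ ≤ β →
      m - ε ≤ (Matrix.gibbsState β (dWaveSourceTorus (L + 1) U μ h) (pairField dWaveFormFactor (L + 1))).re /
        ((L + 1 : ℕ) : ℝ) ^ 2) :
    m ≤ dWaveOrderParameter U μ := by
  refine le_dWaveOrderParameter_of_forall U μ hh₀ fun h hh => ?_
  -- floor `m - ε` on the inner liminf for every `ε > 0`
  refine le_of_forall_pos_lt_add fun ε hε => ?_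
  have hε2 : 0 < ε / 2 := by positivity
  have hfloor : m - ε / 2 ≤ liminf (fun L : ℕ => dWaveSourceDensity (L + 1) U μ h) atTop := by
    refine le_liminf_of_le ?_ ?_
    · exact isCoboundedUnder_ge_of_eventually_le atTop
        (x := 2 * ∑ e ∈ insert (0 : Site 2) unitSteps, |dWaveFormFactor e / Real.sqrt 2|)
        (Eventually.of_forall fun L => dWaveSourceDensity_le_const _ U μ h)
    · filter_upwards [H h hh (ε / 2) hε2] with L hL
      obtain ⟨β₁, hβ₁⟩ := hL
      have := dWaveSourceDensity_ge_of_gibbs_floor (L + 1) U μ h (m := m - ε / 2) (β₁ := β₁) (fun β hβ => ?_)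
      · exact this
      · have := hβ₁ β hβ
        push_cast at this ⊢
        exact this
  linarith

end

end Summit.HubbardSuperconductivity.HubbardSuperconductivity.Theorems
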